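/-
Copyright (c) 2026 the pub-hodgecm-mathlib formalisation cell (harness21).  Prover seat hodgecm-mathlib-K2Liu-p11 (g0), Track B «K2-LIT»,
#184♮ = hLiu418 = `stmt-HodgeConjecture-24832`; LEAD F0P6-plan (g13) RULINGS M-156n (4)∕M-157g∕M-157i′ «A∞ = the SCALAR road, (A∞-R)».
File (A∞-R), scalar `K`-type, OPERATOR LEVEL: `M_w(s) f⁰_{s,k} = c_k(s) · f⁰_{−s,k}` as functions on `U(2,2)`.  THEOREMS ONLY.
-/
import Summits.HodgeConjecture.HodgeConjecture.Theorems.K2LiuArchIntertwiningScalarValue   -- ★ (this seat) (A∞-B) FILE 2: Jacobian lemma, branches, VALUE at `1`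
import Summits.HodgeConjecture.HodgeConjecture.Theorems.K2LiuHermitianTubeCocycle          -- ★ (this seat) H1-B: `Im(g·Z)`, `isUnit_det_denom`, …
import HarnessLib

/-!
# Crux `HLiu418`, A∞ organ, (A∞-R) scalar type: `M_w(s) f⁰_{s,k}(h) = c_k(s) · f⁰_{−s,k}(h)` for every `h ∈ U(2,2)`

Cell `hodgecm-mathlib`, crux item hLiu418 = `stmt-HodgeConjecture-24832` (helper lane `--supports`, count-neutral).

★ FILE 2 gave the VALUE at `h = 1`.  Here the SECTION-LEVEL identity: for `hᴴ J h = J`, `k : ℤ`, `re s > ½`,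
`archIntertwining (archScalarSection k s) h = c_k(s) · archScalarSection k (−s) h` — i.e. the unnormalised intertwining operator maps the
scalar-type vector of `I_w(s)` to `c_k(s)` times the scalar-type vector of `I_w(−s)` (same `k`), with the SAME `c_k(s)` as ★ FILE 2.
No intertwining property / Iwasawa decomposition / `K`-type multiplicity one is used: with `Z = h·(i1) = U + iV` (`V > 0`) and `d = j(h, i1)`,
`j(J n(X) h, i1) = (X + Z)·d` (★ `denom_J_mul_transl`), the `X`-integral is translated by `U` (Haar) and is then Shimura's `ξ(V, 0; α, β)`, whose
value `… det(2V)^{−2s}` (★ FILE 1 `xiTwo_zero_right` at a GENERAL `g = V > 0` — the scaling Jacobian lives there) combines with `det V = |det d|^{−2}`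
(★ `conjTranspose_denom_mul_im_moeb_mul_denom`) to `f⁰_{−s,k}(h)`.
* §1 branches at a general `V > 0`: `det(V − iX) ∈ ℂ ∖ (−∞,0]`, `det(V + iX) = conj det(V − iX)`, `det(X + iV) = −det(V − iX)`, `integrand_eq_of_posDef`;
* §2 `integral_translate_re` — `∫ G(X_r + U + iV) dr = ∫ G(X_r + iV) dr`; `det_im_eq` — `det V = (|det d|²)⁻¹`;
* §3 `archIntertwining_archScalarSection_eq` — the section-level identity.
References: [Shimura1982, (1.25), (1.31)], [Shimura1997, §16] (derived, not cited).
HONEST LABEL: HC_CM is proved only modulo the 7 printed citations (2 remaining named inputs: hLiu418 = stmt-HodgeConjecture-24832,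
h413 = stmt-HodgeConjecture-24833) until rung 0 closes; count-neutral helper, closes no socket.
-/

set_option autoImplicit false
set_option linter.dupNamespace false

noncomputable section

open Complex MeasureTheory Set Matrix
open scoped ComplexOrder ComplexConjugate

namespace Summit.HodgeConjecture.HodgeConjecture.Cruxes.HLiu418.K2LiuArchIntertwiningScalarSection

open Literature.NumberTheory.ModularForms.SiegelUpperHalfSpace (num denom moeb num_def denom_def moeb_def moeb_mul_denom)
open Summit.HodgeConjecture.HodgeConjecture.Cruxes.HLiu418.K2LiuHermTwoGammaDefs
open Summit.HodgeConjecture.HodgeConjecture.Cruxes.HLiu418.K2LiuHermTwoConfluentXiDefs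
open Summit.HodgeConjecture.HodgeConjecture.Cruxes.HLiu418.K2LiuHermTwoXiZeroValue
open Summit.HodgeConjecture.HodgeConjecture.Cruxes.HLiu418.K2LiuHermitianTubeCocycle
open Summit.HodgeConjecture.HodgeConjecture.Cruxes.HLiu418.K2LiuArchInducedTubeDefs
open Summit.HodgeConjecture.HodgeConjecture.Cruxes.HLiu418.K2LiuArchInducedTubeSection
open Summit.HodgeConjecture.HodgeConjecture.Cruxes.HLiu418.K2LiuArchIntertwiningScalarValue

/-! ## §1  Branches at a general `V > 0` -/

/-- `det(V − iX) ∈ ℂ ∖ (−∞, 0]` for `V > 0` and `X` Hermitian (`2 × 2`): if `im det = 0` then `re det > 0`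
(in coordinates: `im = 2Re(w z̄) − (pb + qa)`, `re = (pq − |w|²) − (ab − |z|²)`, and `im = 0` forces `ab − |z|² ≤ 0`). [folklore] -/
theorem det_sub_I_smul_mem_slitPlane {V : Matrix (Fin 2) (Fin 2) ℂ} (hV : V.PosDef) (c : ℝ × ℂ × ℝ) :
    (V - I • hermTwo c).det ∈ slitPlane := by
  obtain ⟨e, rfl⟩ : ∃ e : ℝ × ℂ × ℝ, hermTwo e = V := ⟨_, hermTwo_eq_of_isHermitian hV.1⟩
  obtain ⟨hp, hpq⟩ := (posDef_hermTwo_iff e).mp hV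
  have hre : ((hermTwo e - I • hermTwo c).det).re =
      (e.1 * e.2.2 - normSq e.2.1) - (c.1 * c.2.2 - normSq c.2.1) := by
    rw [det_sub_I_smul_hermTwo]
    simp [Complex.normSq_apply]
    ring
  have him : ((hermTwo e - I • hermTwo c).det).im =
      2 * (e.2.1.re * c.2.1.re + e.2.1.im * c.2.1.im) - (e.1 * c.2.2 + e.2.2 * c.1) := by
    rw [det_sub_I_smul_hermTwo]
    simp
    ring
  rw [mem_slitPlane_iff, hre, him]
  by_cases h0 : 2 * (e.2.1.re * c.2.1.re + e.2.1.im * c.2.1.im) - (e.1 * c.2.2 + e.2.2 * c.1) = 0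
  · left
    have hw0 : 0 ≤ normSq e.2.1 := normSq_nonneg _
    have hz0 : 0 ≤ normSq c.2.1 := normSq_nonneg _
    have hq : 0 < e.2.2 := by nlinarith
    -- Cauchy–Schwarz in `ℝ²`
    have hCS : (e.2.1.re * c.2.1.re + e.2.1.im * c.2.1.im) ^ 2 ≤ normSq e.2.1 * normSq c.2.1 := by
      rw [Complex.normSq_apply, Complex.normSq_apply]
      nlinarith [sq_nonneg (e.2.1.re * c.2.1.im - e.2.1.im * c.2.1.re)]
    by_contra hneg
    rw [not_lt] at hneg
    have hab : normSq c.2.1 < c.1 * c.2.2 := by linarith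
    have hprod : normSq e.2.1 * normSq c.2.1 < (e.1 * e.2.2) * (c.1 * c.2.2) := mul_lt_mul'' hpq hab hw0 hz0
    have hsq : (e.1 * c.2.2 + e.2.2 * c.1) ^ 2 = 4 * (e.2.1.re * c.2.1.re + e.2.1.im * c.2.1.im) ^ 2 := by
      have : e.1 * c.2.2 + e.2.2 * c.1 = 2 * (e.2.1.re * c.2.1.re + e.2.1.im * c.2.1.im) := by linarith
      rw [this]
      ring
    nlinarith [sq_nonneg (e.1 * c.2.2 - e.2.2 * c.1)]
  · right
    exact h0

/-- `det(V + iX) = conj det(V − iX)` for Hermitian `V`, `X = hermTwo c`. [folklore] -/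
theorem det_add_I_smul_eq_conj {V : Matrix (Fin 2) (Fin 2) ℂ} (hV : Vᴴ = V) (c : ℝ × ℂ × ℝ) :
    (V + I • hermTwo c).det = conj ((V - I • hermTwo c).det) := by
  have h : V + I • hermTwo c = (V - I • hermTwo c)ᴴ := by
    rw [conjTranspose_sub, hV, conjTranspose_smul, (isHermitian_hermTwo c).eq, Complex.star_def, conj_I, neg_smul, sub_neg_eq_add]
  rw [h, det_conjTranspose, Complex.star_def]

/-- `X + iV = i(V − iX)`, so `det(X + iV) = −det(V − iX)` (`2 × 2`). [folklore] -/
theorem det_hermTwo_add_I_smul (V : Matrix (Fin 2) (Fin 2) ℂ) (c : ℝ × ℂ × ℝ) :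
    (hermTwo c + I • V).det = -(V - I • hermTwo c).det := by
  have h : hermTwo c + I • V = I • (V - I • hermTwo c) := by
    rw [smul_sub, smul_smul, I_mul_I, neg_one_smul, sub_neg_eq_add, add_comm]
  rw [h, det_smul, Fintype.card_fin, I_sq, neg_one_mul]

/-- **THE INTEGRANDS AGREE at a general `V > 0`**: for `X = hermTwo c`,
`det(X+iV)^{−k}·|det(X+iV)|^{k−2s−2} = xiTwoIntegrand V 0 (s+1+k/2) (s+1−k/2) c`. [Shimura1982, (1.25)] -/
theorem integrand_eq_of_posDef {V : Matrix (Fin 2) (Fin 2) ℂ} (hV : V.PosDef) (k : ℤ) (s : ℂ) (c : ℝ × ℂ × ℝ) :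
    (hermTwo c + I • V).det ^ (-k) * (((‖(hermTwo c + I • V).det‖ : ℝ) : ℂ) ^ ((k : ℂ) - 2 * s - 2)) =
      xiTwoIntegrand V 0 (s + 1 + k / 2) (s + 1 - k / 2) c := by
  set D : ℂ := (V - I • hermTwo c).det with hD
  have hDs : D ∈ slitPlane := det_sub_I_smul_mem_slitPlane hV c
  have hD0 : D ≠ 0 := (mem_slitPlane_iff_arg.mp hDs).2
  have hDπ : D.arg ≠ Real.pi := (mem_slitPlane_iff_arg.mp hDs).1
  have hn0 : ((‖D‖ : ℝ) : ℂ) ≠ 0 := by exact_mod_cast (norm_pos_iff.mpr hD0).ne'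
  rw [xiTwoIntegrand_apply, det_hermTwo_add_I_smul, det_add_I_smul_eq_conj hV.1.eq, ← hD, norm_neg, Matrix.zero_mul,
    Matrix.trace_zero, mul_zero, Complex.exp_zero, one_mul]
  have e1 : (-D) ^ (-k) = cexp ((((-k : ℤ)) : ℂ) * (Real.pi * I)) * cexp (Complex.log D * (((-k : ℤ)) : ℂ)) := by
    rw [Complex.exp_int_mul, Complex.exp_pi_mul_I, ← Complex.cpow_def_of_ne_zero hD0, Complex.cpow_intCast, neg_eq_neg_one_mul,
      mul_zpow]
  have e2 : (((‖D‖ : ℝ) : ℂ)) ^ ((k : ℂ) - 2 * s - 2) = cexp (((Complex.log D).re : ℂ) * ((k : ℂ) - 2 * s - 2)) := by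
    rw [Complex.cpow_def_of_ne_zero hn0, (Complex.ofReal_log (norm_nonneg D)).symm, Complex.log_re]
  have e3 : D ^ (-(s + 1 + k / 2)) = cexp (Complex.log D * (-(s + 1 + k / 2))) := Complex.cpow_def_of_ne_zero hD0 _
  have e4 : (conj D) ^ (-(s + 1 - k / 2)) = cexp (conj (Complex.log D) * (-(s + 1 - k / 2))) := by
    rw [Complex.cpow_def_of_ne_zero ((map_ne_zero _).mpr hD0), Complex.log_conj_eq_ite, if_neg hDπ]
  rw [e1, e2, e3, e4]
  simp only [← Complex.exp_add, mul_assoc]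
  congr 1
  obtain ⟨u, hu⟩ : ∃ u : ℝ, (Complex.log D).re = u := ⟨_, rfl⟩
  obtain ⟨v, hv⟩ : ∃ v : ℝ, (Complex.log D).im = v := ⟨_, rfl⟩
  have hL : Complex.log D = (u : ℂ) + (v : ℂ) * I := by
    rw [← hu, ← hv]
    exact (Complex.re_add_im _).symm
  have hLc : conj (Complex.log D) = (u : ℂ) - (v : ℂ) * I := by
    rw [hL, map_add, map_mul, Complex.conj_ofReal, Complex.conj_ofReal, Complex.conj_I]
    ring
  rw [hLc, hu, hL]
  push_cast
  ring

/-! ## §2  Translation by `Re Z` and the determinant of `Im Z` -/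

/-- Translating the `hermOfReal`-integral by a Hermitian `U`: `∫ G(X_r + U) dr = ∫ G(X_r) dr` (Haar). [folklore] -/
theorem integral_translate {U : Matrix (Fin 2) (Fin 2) ℂ} (hU : Uᴴ = U) (G : Matrix (Fin 2) (Fin 2) ℂ → ℂ) :
    ∫ r : Fin 2 → Fin 2 → ℝ, G (hermOfReal r + U) = ∫ r : Fin 2 → Fin 2 → ℝ, G (hermOfReal r) := by
  obtain ⟨r₀, hr₀⟩ := exists_hermOfReal_eq hU
  have h : (fun r : Fin 2 → Fin 2 → ℝ => G (hermOfReal r + U)) = fun r => (fun r' => G (hermOfReal r')) (r + r₀) := by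
    funext r
    simp only [hermOfReal_add, hr₀]
  rw [h, integral_add_right_eq_self (fun r' : Fin 2 → Fin 2 → ℝ => G (hermOfReal r')) r₀]

/-- For `h ∈ U(J)`: with `d = j(h, i1)` and `V = Im(h·i1)`, `dᴴ V d = 1`, hence `det V = (|det d|²)⁻¹` (a positive real). [Shimura1997, §6.3] -/
theorem det_im_eq {h : Matrix (Fin 2 ⊕ Fin 2) (Fin 2 ⊕ Fin 2) ℂ} (hh : hᴴ * Matrix.J (Fin 2) ℂ * h = Matrix.J (Fin 2) ℂ) :
    ((2 * I)⁻¹ • (moeb h (I • (1 : Matrix (Fin 2) (Fin 2) ℂ)) - (moeb h (I • (1 : Matrix (Fin 2) (Fin 2) ℂ)))ᴴ)).det =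
      (((‖(denom h (I • (1 : Matrix (Fin 2) (Fin 2) ℂ))).det‖ ^ 2)⁻¹ : ℝ) : ℂ) := by
  have hkey := conjTranspose_denom_mul_im_moeb_mul_denom hh (Z := I • (1 : Matrix (Fin 2) (Fin 2) ℂ)) posDef_im_I_smul_one
  rw [im_I_smul_one] at hkey
  have hdet := congrArg Matrix.det hkey
  rw [det_mul, det_mul, det_conjTranspose, det_one, Complex.star_def] at hdet
  have hd0 : (denom h (I • (1 : Matrix (Fin 2) (Fin 2) ℂ))).det ≠ 0 := (isUnit_det_denom hh posDef_im_I_smul_one).ne_zero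
  have hn : conj ((denom h (I • (1 : Matrix (Fin 2) (Fin 2) ℂ))).det) * (denom h (I • (1 : Matrix (Fin 2) (Fin 2) ℂ))).det =
      (((‖(denom h (I • (1 : Matrix (Fin 2) (Fin 2) ℂ))).det‖ ^ 2 : ℝ)) : ℂ) := by
    rw [← Complex.normSq_eq_conj_mul_self, Complex.normSq_eq_norm_sq]
  have hn0 : (((‖(denom h (I • (1 : Matrix (Fin 2) (Fin 2) ℂ))).det‖ ^ 2 : ℝ)) : ℂ) ≠ 0 := by
    have : (‖(denom h (I • (1 : Matrix (Fin 2) (Fin 2) ℂ))).det‖ ^ 2 : ℝ) ≠ 0 := by positivity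
    exact_mod_cast this
  -- `conj δ · det V · δ = 1`
  have h1 : (((‖(denom h (I • (1 : Matrix (Fin 2) (Fin 2) ℂ))).det‖ ^ 2 : ℝ)) : ℂ) *
      ((2 * I)⁻¹ • (moeb h (I • (1 : Matrix (Fin 2) (Fin 2) ℂ)) - (moeb h (I • (1 : Matrix (Fin 2) (Fin 2) ℂ)))ᴴ)).det = 1 := by
    rw [← hn, ← hdet]
    ring
  rw [Complex.ofReal_inv]
  exact (eq_inv_of_mul_eq_one_right h1)

/-! ## §3  The section-level identity -/

/-- `((x²)⁻¹)^{−2s} = x^{4s}` for a positive real `x` (principal powers). [folklore] -/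
theorem inv_sq_cpow {x : ℝ} (hx : 0 < x) (s : ℂ) :
    ((((x ^ 2)⁻¹ : ℝ)) : ℂ) ^ (-(2 * s)) = ((x : ℝ) : ℂ) ^ (4 * s) := by
  have hx0 : ((x : ℝ) : ℂ) ≠ 0 := by exact_mod_cast hx.ne'
  have hy : (0 : ℝ) < (x ^ 2)⁻¹ := by positivity
  have hy0 : ((((x ^ 2)⁻¹ : ℝ)) : ℂ) ≠ 0 := by exact_mod_cast hy.ne'
  rw [Complex.cpow_def_of_ne_zero hy0, Complex.cpow_def_of_ne_zero hx0, ← Complex.ofReal_log hy.le, ← Complex.ofReal_log hx.le,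
    Real.log_inv, Real.log_pow]
  congr 1
  push_cast
  ring

/-- **`M_w(s) f⁰_{s,k} = c_k(s) · f⁰_{−s,k}` ON `U(2,2)`** ((A∞-R), scalar type; the SAME `c_k(s)` as ★ FILE 2's value at `1`):
for `hᴴ J h = J`, `k : ℤ`, `re s > ½`,
`archIntertwining (archScalarSection k s) h = (1/8)·(4π⁴·e^{−iπk}·Γ₂(s+1+k/2)⁻¹·Γ₂(s+1−k/2)⁻¹·(Γ₂(2s)·4^{−2s})) · archScalarSection k (−s) h`.
[Shimura1982, (1.31); Shimura1997, §16] -/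
theorem archIntertwining_archScalarSection_eq (k : ℤ) {s : ℂ} (hs : 1 / 2 < s.re) {h : Matrix (Fin 2 ⊕ Fin 2) (Fin 2 ⊕ Fin 2) ℂ}
    (hh : hᴴ * Matrix.J (Fin 2) ℂ * h = Matrix.J (Fin 2) ℂ) :
    archIntertwining (archScalarSection k s) h =
      (1 / 8 : ℂ) * (((4 * Real.pi ^ 4 : ℝ) : ℂ) * cexp (-(Real.pi * I) * k) * (hermTwoGamma (s + 1 + k / 2))⁻¹ *
        (hermTwoGamma (s + 1 - k / 2))⁻¹ * (hermTwoGamma (2 * s) * (4 : ℂ) ^ (-(2 * s)))) * archScalarSection k (-s) h := by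
  -- names: `Z = h·i1 = U + iV`, `d = j(h, i1)`, `δ = det d`
  obtain ⟨Z, hZ⟩ : ∃ Z : Matrix (Fin 2) (Fin 2) ℂ, Z = moeb h (I • (1 : Matrix (Fin 2) (Fin 2) ℂ)) := ⟨_, rfl⟩
  obtain ⟨d, hd⟩ : ∃ d : Matrix (Fin 2) (Fin 2) ℂ, d = denom h (I • (1 : Matrix (Fin 2) (Fin 2) ℂ)) := ⟨_, rfl⟩
  obtain ⟨U, hU⟩ : ∃ U : Matrix (Fin 2) (Fin 2) ℂ, U = (2 : ℂ)⁻¹ • (Z + Zᴴ) := ⟨_, rfl⟩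
  obtain ⟨V, hV⟩ : ∃ V : Matrix (Fin 2) (Fin 2) ℂ, V = (2 * I)⁻¹ • (Z - Zᴴ) := ⟨_, rfl⟩
  have hdu : IsUnit d.det := by
    rw [hd]
    exact isUnit_det_denom hh posDef_im_I_smul_one
  have hδ0 : d.det ≠ 0 := hdu.ne_zero
  have hVpos : V.PosDef := by
    rw [hV, hZ]
    exact posDef_im_moeb hh posDef_im_I_smul_one
  have hUh : Uᴴ = U := by
    rw [hU]
    exact (isHermitian_re Z).eq
  have hZUV : Z = U + I • V := by
    rw [hU, hV]
    exact (re_add_I_smul_im Z).symm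
  have hdetV : V.det = (((‖d.det‖ ^ 2)⁻¹ : ℝ) : ℂ) := by
    rw [hV, hZ, hd]
    exact det_im_eq hh
  -- the exponents
  have hαβ : 3 < ((s + 1 + k / 2) + (s + 1 - k / 2)).re := by
    have : ((s + 1 + k / 2) + (s + 1 - k / 2) : ℂ) = 2 * s + 2 := by ring
    rw [this, Complex.add_re, Complex.mul_re]
    norm_num
    linarith
  have e2 : ((s + 1 + k / 2) + (s + 1 - k / 2) - 2 : ℂ) = 2 * s := by ring
  have e1 : (Real.pi * I) * ((s + 1 - k / 2) - (s + 1 + k / 2)) = -(Real.pi * I) * k := by ring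
  -- (1) the integrand, pointwise in `r`
  have hpt : ∀ r : Fin 2 → Fin 2 → ℝ,
      archScalarSection k s (Matrix.J (Fin 2) ℂ * fromBlocks 1 (hermOfReal r) 0 1 * h) =
        (d.det ^ (-k) * (((‖d.det‖ : ℝ) : ℂ) ^ ((k : ℂ) - 2 * s - 2))) *
          ((hermOfReal r + U + I • V).det ^ (-k) * (((‖(hermOfReal r + U + I • V).det‖ : ℝ) : ℂ) ^ ((k : ℂ) - 2 * s - 2))) := by
    intro r
    have hden : denom (Matrix.J (Fin 2) ℂ * fromBlocks 1 (hermOfReal r) 0 1 * h) (I • 1) = (hermOfReal r + U + I • V) * d := by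
      rw [denom_J_mul_transl, ← hd, ← moeb_mul_denom (P := h) (Z := I • 1) (hd ▸ hdu), ← hZ, ← hd, hZUV, ← Matrix.add_mul]
      congr 1
      abel
    rw [archScalarSection_apply, Fintype.card_fin, Nat.cast_ofNat, hden, det_mul, mul_zpow, norm_mul, Complex.ofReal_mul,
      Complex.mul_cpow_ofReal_nonneg (norm_nonneg _) (norm_nonneg _)]
    ring
  -- (2) the integral: constant out, translate by `U`, Jacobian, Shimura's `ξ(V, 0)`
  have hint : archIntertwining (archScalarSection k s) h =
      (d.det ^ (-k) * (((‖d.det‖ : ℝ) : ℂ) ^ ((k : ℂ) - 2 * s - 2))) * ((1 / 8 : ℂ) * xiTwo V 0 (s + 1 + k / 2) (s + 1 - k / 2)) := by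
    rw [archIntertwining_apply]
    simp only [hpt]
    rw [integral_const_mul]
    congr 1
    have ht := integral_translate hUh (fun Y => (Y + I • V).det ^ (-k) * (((‖(Y + I • V).det‖ : ℝ) : ℂ) ^ ((k : ℂ) - 2 * s - 2)))
    rw [ht, integral_hermOfReal_eq (fun Y => (Y + I • V).det ^ (-k) * (((‖(Y + I • V).det‖ : ℝ) : ℂ) ^ ((k : ℂ) - 2 * s - 2))),
      xiTwo_def]
    congr 1
    exact integral_congr_ae (Filter.Eventually.of_forall fun c => integrand_eq_of_posDef hVpos k s c)
  -- (3) the value of `ξ(V, 0)` and `det(2V) = 4·(|δ|²)⁻¹`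
  have hdet2V : ((2 : ℂ) • V).det = (((4 : ℝ)) : ℂ) * ((((‖d.det‖ ^ 2)⁻¹ : ℝ)) : ℂ) := by
    rw [det_smul, Fintype.card_fin, hdetV]
    norm_num
  have hpos : 0 < ‖d.det‖ := norm_pos_iff.mpr hδ0
  have hpow : (((2 : ℂ) • V).det) ^ (-(2 * s)) = (4 : ℂ) ^ (-(2 * s)) * (((‖d.det‖ : ℝ) : ℂ) ^ (4 * s)) := by
    rw [hdet2V, Complex.mul_cpow_ofReal_nonneg (by norm_num) (by positivity), inv_sq_cpow hpos]
    norm_num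
  rw [hint, xiTwo_zero_right hVpos hαβ, e1, e2, hpow, archScalarSection_apply, Fintype.card_fin, Nat.cast_ofNat, ← hd]
  -- (4) exponent bookkeeping: `|δ|^{k−2s−2} · |δ|^{4s} = |δ|^{k−2(−s)−2}`
  have hn0 : (((‖d.det‖ : ℝ)) : ℂ) ≠ 0 := by exact_mod_cast hpos.ne'
  have hexp : (((‖d.det‖ : ℝ) : ℂ) ^ ((k : ℂ) - 2 * s - 2)) * (((‖d.det‖ : ℝ) : ℂ) ^ (4 * s)) =
      ((‖d.det‖ : ℝ) : ℂ) ^ ((k : ℂ) - 2 * (-s) - 2) := by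
    rw [← Complex.cpow_add _ _ hn0]
    congr 1
    ring
  rw [← hexp]
  ring

end Summit.HodgeConjecture.HodgeConjecture.Cruxes.HLiu418.K2LiuArchIntertwiningScalarSection

end
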